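import Literature.Analysis.FluidPDE.JiaSverak2013Lemma8Layer
import HarnessLib

/-!
# The Grönwall step of the caloric layer estimate on a time interval `(0, T₀)`, `T₀ ≤ 1`

Analysis/FluidPDE proof file (theorems only, no definitions, no named facts) on the way to the
discharge of `Literature.Analysis.FluidPDE.BarkerPrange2020_thm2` (Barker–Prange 2020, Thm. 2) by
compactness. `Literature.Analysis.FluidPDE.decay_of_window` (`JiaSverak2013Lemma8Layer.lean`,
Jia–Šverák 2013, proof of Lemma 8, Grönwall step) is stated on the unit time interval: windowed
inequalities for all `0 < δ`, `4δ ≤ τ < 1` give `Y(τ) ≤ a(τ) e^{1 + K₀ ∫₀¹ P}` for a.e.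
`τ ∈ (0, 1)`. The local energy solutions produced by the rescaling argument of Barker–Prange live
on `(0, σ)` with `σ < 1`, so the windowed inequalities are only available for `τ < σ`; this file
transports the lemma to `(0, T₀)`, `0 < T₀ ≤ 1` (`decay_of_window_of_le_one`), by the time
dilation `s ↦ T₀ s`: the edge kernels `ρ^±` and the plateau `σ_{δ,τ}` are dilation covariant
(`ρ⁻_{T₀δ,T₀τ}(T₀s) = T₀⁻¹ρ⁻_{δ,τ}(s)`, `σ_{T₀δ,T₀τ}(T₀s) = σ_{δ,τ}(s)`), the Grönwall density
becomes `T₀ P(T₀ s)` with the same integral, and the plateau term picks up the harmless factor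
`T₀ ≤ 1`.

## References

* H. Jia, V. Šverák, SIAM J. Math. Anal. 45 (2013) 1448–1459 = arXiv:1201.1592, Lemma 8 (p. 7).
  [JiaSverak2013]
* T. Barker, C. Prange, Arch. Ration. Mech. Anal. 236 (2020) 1487–1541 = arXiv:1812.09115, Thm. 2,
  §4.2 (p. 16). [BarkerPrange2020]
-/

noncomputable section

open MeasureTheory Set Function Filter
open _root_.Topology
open scoped ENNReal NNReal

namespace Literature.Analysis.FluidPDE

namespace BarkerPrange2020

/-! ## Dilations of the line: integrals and null sets -/

section Dilation

/-- `∫ g = T₀ ∫ g(T₀ s) ds` for `T₀ > 0` (Bochner, real line). [folklore] -/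
theorem integral_eq_mul_integral_comp_mul {T₀ : ℝ} (hT₀ : 0 < T₀) (g : ℝ → ℝ) :
    ∫ t, g t = T₀ * ∫ s, g (T₀ * s) := by
  rw [Measure.integral_comp_mul_left g T₀, abs_of_pos (inv_pos.2 hT₀), smul_eq_mul, ← mul_assoc,
    mul_inv_cancel₀ hT₀.ne', one_mul]

/-- `∫⁻ f = T₀ ∫⁻ f(T₀ s) ds` for `T₀ > 0` (Lebesgue integral, real line). [folklore] -/
theorem lintegral_eq_mul_lintegral_comp_mul {T₀ : ℝ} (hT₀ : 0 < T₀) (f : ℝ → ℝ≥0∞) :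
    ∫⁻ t, f t = ENNReal.ofReal T₀ * ∫⁻ s, f (T₀ * s) := by
  set e : ℝ ≃ᵐ ℝ := (Homeomorph.mulLeft₀ T₀ hT₀.ne').toMeasurableEquiv with he
  have hcoe : (e : ℝ → ℝ) = fun s => T₀ * s := rfl
  have h1 := lintegral_map_equiv (μ := volume) f e
  rw [hcoe, Real.map_volume_mul_left hT₀.ne', lintegral_smul_measure, abs_of_pos (inv_pos.2 hT₀),
    smul_eq_mul] at h1
  rw [← h1, ← mul_assoc, ← ENNReal.ofReal_mul hT₀.le, mul_inv_cancel₀ hT₀.ne', ENNReal.ofReal_one, one_mul]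

/-- Set version on `(0, T₀)`: `∫⁻_{(0,T₀)} f = T₀ ∫⁻_{(0,1)} f(T₀ s) ds`. [folklore] -/
theorem setLIntegral_Ioo_eq_mul_lintegral_comp_mul {T₀ : ℝ} (hT₀ : 0 < T₀) (f : ℝ → ℝ≥0∞) :
    ∫⁻ t in Ioo 0 T₀, f t = ENNReal.ofReal T₀ * ∫⁻ s in Ioo 0 1, f (T₀ * s) := by
  rw [← lintegral_indicator measurableSet_Ioo, ← lintegral_indicator measurableSet_Ioo,
    lintegral_eq_mul_lintegral_comp_mul hT₀]
  congr 1
  refine lintegral_congr fun s => ?_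
  have hmem : T₀ * s ∈ Ioo 0 T₀ ↔ s ∈ Ioo (0 : ℝ) 1 := by
    rw [mem_Ioo, mem_Ioo, mul_pos_iff_of_pos_left hT₀, mul_lt_iff_lt_one_right hT₀]
  by_cases hs : s ∈ Ioo (0 : ℝ) 1
  · rw [indicator_of_mem hs, indicator_of_mem (hmem.2 hs)]
  · rw [indicator_of_notMem hs, indicator_of_notMem (fun h => hs (hmem.1 h))]

/-- Null sets of `(0, T₀)` pull back to null sets of `(0, 1)` under `s ↦ T₀ s`. [folklore] -/
theorem ae_restrict_Ioo_comp_mul {T₀ : ℝ} (hT₀ : 0 < T₀) {p : ℝ → Prop}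
    (hp : ∀ᵐ t ∂(volume.restrict (Ioo (0 : ℝ) T₀)), p t) :
    ∀ᵐ s ∂(volume.restrict (Ioo (0 : ℝ) 1)), p (T₀ * s) := by
  rw [ae_restrict_iff' measurableSet_Ioo] at hp ⊢
  rw [ae_iff] at hp ⊢
  have hsub : {s : ℝ | ¬(s ∈ Ioo (0 : ℝ) 1 → p (T₀ * s))} ⊆
      (fun s : ℝ => T₀ * s) ⁻¹' {t : ℝ | ¬(t ∈ Ioo (0 : ℝ) T₀ → p t)} := by
    intro s hs
    simp only [mem_setOf_eq, Classical.not_imp, mem_preimage, mem_Ioo] at hs ⊢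
    refine ⟨⟨mul_pos hT₀ hs.1.1, ?_⟩, hs.2⟩
    calc T₀ * s < T₀ * 1 := mul_lt_mul_of_pos_left hs.1.2 hT₀
      _ = T₀ := mul_one _
  refine measure_mono_null hsub ?_
  rw [Real.volume_preimage_mul_left hT₀.ne', hp, mul_zero]

/-- Null sets of `(0, 1)` push forward to null sets of `(0, T₀)` under `s ↦ T₀ s`. [folklore] -/
theorem ae_restrict_Ioo_of_comp_mul {T₀ : ℝ} (hT₀ : 0 < T₀) {p : ℝ → Prop}
    (hp : ∀ᵐ s ∂(volume.restrict (Ioo (0 : ℝ) 1)), p (T₀ * s)) :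
    ∀ᵐ t ∂(volume.restrict (Ioo (0 : ℝ) T₀)), p t := by
  rw [ae_restrict_iff' measurableSet_Ioo] at hp ⊢
  rw [ae_iff] at hp ⊢
  have hsub : {t : ℝ | ¬(t ∈ Ioo (0 : ℝ) T₀ → p t)} ⊆
      (fun t : ℝ => T₀⁻¹ * t) ⁻¹' {s : ℝ | ¬(s ∈ Ioo (0 : ℝ) 1 → p (T₀ * s))} := by
    intro t ht
    simp only [mem_setOf_eq, Classical.not_imp, mem_preimage, mem_Ioo] at ht ⊢
    rw [mul_inv_cancel_left₀ hT₀.ne']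
    refine ⟨⟨mul_pos (inv_pos.2 hT₀) ht.1.1, ?_⟩, ht.2⟩
    calc T₀⁻¹ * t < T₀⁻¹ * T₀ := mul_lt_mul_of_pos_left ht.1.2 (inv_pos.2 hT₀)
      _ = 1 := inv_mul_cancel₀ hT₀.ne'
  refine measure_mono_null hsub ?_
  rw [Real.volume_preimage_mul_left (inv_ne_zero hT₀.ne'), hp, mul_zero]

end Dilation

/-! ## The Grönwall step on `(0, T₀)` -/

section Main

/-- Dilation covariance of the plateau: `σ_{T₀δ,T₀τ}(T₀ s) = σ_{δ,τ}(s)`. [folklore] -/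
theorem timePlateau_mul {T₀ : ℝ} (hT₀ : T₀ ≠ 0) (δ τ s : ℝ) :
    timePlateau (T₀ * δ) (T₀ * τ) (T₀ * s) = timePlateau δ τ s := by
  unfold timePlateau
  rw [show T₀ * s - T₀ * δ = T₀ * (s - δ) by ring, mul_div_mul_left _ _ hT₀,
    show T₀ * τ - T₀ * δ - T₀ * s = T₀ * (τ - δ - s) by ring, mul_div_mul_left _ _ hT₀]

/-- Dilation covariance of the falling edge kernel:
`ρ⁻_{T₀δ,T₀τ}(T₀ s) = T₀⁻¹ ρ⁻_{δ,τ}(s)`. [folklore] -/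
theorem plateauFall_mul {T₀ : ℝ} (hT₀ : T₀ ≠ 0) (δ τ s : ℝ) :
    (1 / (T₀ * δ)) * deriv Real.smoothTransition ((T₀ * τ - T₀ * δ - T₀ * s) / (T₀ * δ)) =
      T₀⁻¹ * ((1 / δ) * deriv Real.smoothTransition ((τ - δ - s) / δ)) := by
  rw [show T₀ * τ - T₀ * δ - T₀ * s = T₀ * (τ - δ - s) by ring, mul_div_mul_left _ _ hT₀,
    one_div, mul_inv, one_div, mul_assoc]

/-- Dilation covariance of the rising edge kernel: `ρ⁺_{T₀δ}(T₀ s) = T₀⁻¹ ρ⁺_δ(s)`. [folklore] -/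
theorem plateauRise_mul {T₀ : ℝ} (hT₀ : T₀ ≠ 0) (δ s : ℝ) :
    (1 / (T₀ * δ)) * deriv Real.smoothTransition ((T₀ * s - T₀ * δ) / (T₀ * δ)) =
      T₀⁻¹ * ((1 / δ) * deriv Real.smoothTransition ((s - δ) / δ)) := by
  rw [show T₀ * s - T₀ * δ = T₀ * (s - δ) by ring, mul_div_mul_left _ _ hT₀,
    one_div, mul_inv, one_div, mul_assoc]

/-- **From the windowed energy bound to the decay at almost every time, on `(0, T₀)`,
`0 < T₀ ≤ 1`.** The statement of `Literature.Analysis.FluidPDE.decay_of_window` (Jia–Šverák 2013,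
proof of Lemma 8, Grönwall step) with the unit time interval replaced by `(0, T₀)`: `Y ≥ 0`
measurable and a.e. bounded on `(0, T₀)` with `Y(t) → 0` as `t → 0⁺`, `P ≥ 0` with `∫₀^{T₀} P < ∞`,
`K₀ ≥ 0`, `a ≥ 0` non-decreasing, and the windowed inequalities
`∫ ρ⁻_{δ,τ} Y ≤ ∫ ρ⁺_δ Y + ∫ σ_{δ,τ} Y + K₀ ∫ σ_{δ,τ} P Y + a(τ)` for `0 < δ`, `4δ ≤ τ < T₀`; then
`Y(τ) ≤ a(τ) exp(1 + K₀ ∫₀^{T₀} P)` for a.e. `τ ∈ (0, T₀)`. Proof: apply `decay_of_window` to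
`s ↦ Y(T₀ s)`, `s ↦ T₀ P(T₀ s)`, `s ↦ a(T₀ s)` (dilation covariance of the kernels, `T₀ ≤ 1`).
[cite: JiaSverak2013, Lemma 8, proof (arXiv:1201.1592 p. 7); BarkerPrange2020, §4.2 (arXiv:1812.09115 p. 16)] -/
theorem decay_of_window_of_le_one {T₀ : ℝ} (hT₀ : 0 < T₀) (hT₀1 : T₀ ≤ 1) {Y P a : ℝ → ℝ} {Ybar K₀ : ℝ}
    (hY0 : ∀ t, 0 ≤ Y t) (hYm : AEStronglyMeasurable Y (volume.restrict (Ioo (0 : ℝ) T₀)))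
    (hYb : ∀ᵐ t ∂(volume.restrict (Ioo (0 : ℝ) T₀)), Y t ≤ Ybar)
    (hYlim : Tendsto Y (𝓝[>] 0) (𝓝 0))
    (hP0 : ∀ t, 0 ≤ P t) (hPfin : ∫⁻ t in Ioo (0 : ℝ) T₀, ENNReal.ofReal (P t) < ∞)
    (hK₀ : 0 ≤ K₀) (ha0 : ∀ t, 0 ≤ a t) (hmono : Monotone a)
    (hwin : ∀ δ τ : ℝ, 0 < δ → 4 * δ ≤ τ → τ < T₀ →
      ∫ t, ((1 / δ) * deriv Real.smoothTransition ((τ - δ - t) / δ)) * Y t ≤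
        (∫ t, ((1 / δ) * deriv Real.smoothTransition ((t - δ) / δ)) * Y t) +
        (∫ t, timePlateau δ τ t * Y t) +
        K₀ * (∫⁻ t, ENNReal.ofReal (timePlateau δ τ t * (P t * Y t))).toReal + a τ) :
    ∀ᵐ τ ∂(volume.restrict (Ioo (0 : ℝ) T₀)),
      Y τ ≤ a τ * Real.exp (1 + K₀ * (∫⁻ t in Ioo (0 : ℝ) T₀, ENNReal.ofReal (P t)).toReal) := by
  have hT₀' : T₀ ≠ 0 := hT₀.ne'
  -- the dilated data
  set Ys : ℝ → ℝ := fun s => Y (T₀ * s) with hYs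
  set Ps : ℝ → ℝ := fun s => T₀ * P (T₀ * s) with hPs
  set as : ℝ → ℝ := fun s => a (T₀ * s) with has
  -- the Grönwall integral is dilation invariant
  have hPI : ∫⁻ s in Ioo (0 : ℝ) 1, ENNReal.ofReal (Ps s) = ∫⁻ t in Ioo (0 : ℝ) T₀, ENNReal.ofReal (P t) := by
    rw [setLIntegral_Ioo_eq_mul_lintegral_comp_mul hT₀, ← lintegral_const_mul' _ _ ENNReal.ofReal_ne_top]
    refine lintegral_congr fun s => ?_
    rw [hPs, ENNReal.ofReal_mul hT₀.le]
  -- hypotheses of the unit-interval lemma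
  have hY0' : ∀ s, 0 ≤ Ys s := fun s => hY0 _
  have hYm' : AEStronglyMeasurable Ys (volume.restrict (Ioo (0 : ℝ) 1)) := by
    obtain ⟨g, hg, hYg⟩ := hYm
    refine ⟨fun s => g (T₀ * s), hg.comp_measurable (measurable_const_mul T₀), ?_⟩
    exact ae_restrict_Ioo_comp_mul hT₀ (p := fun t => Y t = g t) hYg
  have hYb' : ∀ᵐ s ∂(volume.restrict (Ioo (0 : ℝ) 1)), Ys s ≤ Ybar :=
    ae_restrict_Ioo_comp_mul hT₀ (p := fun t => Y t ≤ Ybar) hYb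
  have hYlim' : Tendsto Ys (𝓝[>] 0) (𝓝 0) := by
    refine hYlim.comp ?_
    refine tendsto_nhdsWithin_of_tendsto_nhds_of_eventually_within _ ?_ ?_
    · have : Tendsto (fun s : ℝ => T₀ * s) (𝓝 0) (𝓝 (T₀ * 0)) := (continuous_const.mul continuous_id).tendsto 0
      rw [mul_zero] at this
      exact this.mono_left nhdsWithin_le_nhds
    · filter_upwards [self_mem_nhdsWithin] with s hs
      exact mul_pos hT₀ hs
  have hP0' : ∀ s, 0 ≤ Ps s := fun s => mul_nonneg hT₀.le (hP0 _)
  have hPfin' : ∫⁻ s in Ioo (0 : ℝ) 1, ENNReal.ofReal (Ps s) < ∞ := by rw [hPI]; exact hPfin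
  have ha0' : ∀ s, 0 ≤ as s := fun s => ha0 _
  have hmono' : Monotone as := fun s₁ s₂ h => hmono (mul_le_mul_of_nonneg_left h hT₀.le)
  -- the dilated windowed inequalities
  have hwin' : ∀ δ τ : ℝ, 0 < δ → 4 * δ ≤ τ → τ < 1 →
      ∫ s, ((1 / δ) * deriv Real.smoothTransition ((τ - δ - s) / δ)) * Ys s ≤
        (∫ s, ((1 / δ) * deriv Real.smoothTransition ((s - δ) / δ)) * Ys s) +
        (∫ s, timePlateau δ τ s * Ys s) +
        K₀ * (∫⁻ s, ENNReal.ofReal (timePlateau δ τ s * (Ps s * Ys s))).toReal + as τ := by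
    intro δ τ hδ hδτ hτ1
    have H := hwin (T₀ * δ) (T₀ * τ) (mul_pos hT₀ hδ) (by nlinarith) (by nlinarith)
    -- left-hand side
    have eL : ∫ t, ((1 / (T₀ * δ)) * deriv Real.smoothTransition ((T₀ * τ - T₀ * δ - t) / (T₀ * δ))) * Y t =
        ∫ s, ((1 / δ) * deriv Real.smoothTransition ((τ - δ - s) / δ)) * Ys s := by
      rw [integral_eq_mul_integral_comp_mul hT₀, ← integral_const_mul]
      refine integral_congr_ae (Eventually.of_forall fun s => ?_)
      simp only [hYs]
      rw [plateauFall_mul hT₀', ← mul_assoc, ← mul_assoc, mul_inv_cancel₀ hT₀', one_mul]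
    have eR1 : ∫ t, ((1 / (T₀ * δ)) * deriv Real.smoothTransition ((t - T₀ * δ) / (T₀ * δ))) * Y t =
        ∫ s, ((1 / δ) * deriv Real.smoothTransition ((s - δ) / δ)) * Ys s := by
      rw [integral_eq_mul_integral_comp_mul hT₀, ← integral_const_mul]
      refine integral_congr_ae (Eventually.of_forall fun s => ?_)
      simp only [hYs]
      rw [plateauRise_mul hT₀', ← mul_assoc, ← mul_assoc, mul_inv_cancel₀ hT₀', one_mul]
    have eR2 : ∫ t, timePlateau (T₀ * δ) (T₀ * τ) t * Y t = T₀ * ∫ s, timePlateau δ τ s * Ys s := by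
      rw [integral_eq_mul_integral_comp_mul hT₀]
      congr 1
      refine integral_congr_ae (Eventually.of_forall fun s => ?_)
      simp only [hYs]
      rw [timePlateau_mul hT₀']
    have eR3 : ∫⁻ t, ENNReal.ofReal (timePlateau (T₀ * δ) (T₀ * τ) t * (P t * Y t)) =
        ∫⁻ s, ENNReal.ofReal (timePlateau δ τ s * (Ps s * Ys s)) := by
      rw [lintegral_eq_mul_lintegral_comp_mul hT₀, ← lintegral_const_mul' _ _ ENNReal.ofReal_ne_top]
      refine lintegral_congr fun s => ?_
      simp only [hYs, hPs]
      rw [timePlateau_mul hT₀', ← ENNReal.ofReal_mul hT₀.le]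
      congr 1
      ring
    rw [eL, eR1, eR2, eR3] at H
    have hI0 : 0 ≤ ∫ s, timePlateau δ τ s * Ys s :=
      integral_nonneg fun s => mul_nonneg (timePlateau_nonneg δ τ s) (hY0 _)
    have hle : T₀ * ∫ s, timePlateau δ τ s * Ys s ≤ ∫ s, timePlateau δ τ s * Ys s := by
      nlinarith
    linarith
  -- the unit-interval lemma and the transport back
  have hD := decay_of_window hY0' hYm' hYb' hYlim' hP0' hPfin' hK₀ ha0' hmono' hwin'
  rw [hPI] at hD
  have hD' := ae_restrict_Ioo_of_comp_mul hT₀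
    (p := fun t => Y t ≤ a t * Real.exp (1 + K₀ * (∫⁻ t in Ioo (0 : ℝ) T₀, ENNReal.ofReal (P t)).toReal)) hD
  exact hD'

end Main

end BarkerPrange2020

end Literature.Analysis.FluidPDE

end
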